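import Mathlib.FieldTheory.Finite.Basic
import Mathlib.Algebra.Polynomial.Roots
import Mathlib.Algebra.Polynomial.Div
import Mathlib.RingTheory.Finiteness.Cardinality
import Mathlib.Algebra.Field.ZMod
import Mathlib.Data.Nat.Prime.Factorial
import Mathlib.Tactic.LinearCombination
import Mathlib.Tactic.FieldSimp
import Mathlib.Tactic.IntervalCases
import HarnessLib

/-!
# HyperplaneLemma — functions with vanishing line sums over `𝔽_p` (PART C1 of PlaneDivAscent; C2, C3 continue)
(cell decomp-qadv, lens 6 «barrier-complement carving», g21 REV2; tree-ready, Prop-definition-free;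
Parts A/B = `Theorems.CharDialPlaneDivAscentA/B` (landed); Part D = `Theorems.CharDialPlaneDivAscentD`:
the hyperplane ascent and the dimension elimination `law_iff_succ`, which consumes `hl_abstract` below.)

THE HYPERPLANE LEMMA (`hl_abstract`).  Let `M` be a finite-dimensional `𝔽_p`-vector space and
`g : M → 𝔽_p` a function all of whose LINE SUMS vanish (`∀ y v, Σ_t g (y + t•v) = 0`; for `p` odd these are
exactly the reduced polynomials of degree `≤ p - 2`).  If `g` vanishes on `p - 1` pairwise distinct affine
hyperplanes `{φ_i = c_i}` (`φ_i ≠ 0`, the pairs `(φ_i, c_i)` pairwise non-proportional), then `g = 0`.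

Proof formalised here from scratch (Mathlib has no Reed–Muller theory):
* §1 bivariate polynomials `P : 𝔽_p[X][Y]` (outer variable = second coordinate), evaluation `ev`,
  restriction to a line `b = μ + ν a` (`eval_eval_eq_ev`), total degree bookkeeping
  («`∀ j, P_j ≠ 0 → deg P_j + j ≤ D`»), root counts (`poly_eq_zero_of_eval(_off_one)`);
* §2 PEELING (`peel`): if `P` (total degree `≤ D < p`) vanishes on the line `b = μ + ν a` then
  `P = (Y - μ - νX) · Q` with `Q` of total degree `≤ D - 1` (synthetic division,
  `Polynomial.coeff_divByMonic_X_sub_C_rec`); the quotient still vanishes on every other line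
  (`vanish_quot`); iterating over `D + 1` lines with distinct parameters kills `P` (`eq_zero_of_lines`);
* §3 INTERPOLATION (`interp₂`, `ev_interp₂`) and the DEGREE LEMMA (`td_interp₂`): if all line sums of `G`
  in the directions `(1, λ)` vanish then the interpolant has total degree `≤ p - 2` — the `c`-polynomials
  `Φ_λ(c) = Σ_t G(t, c + λt)` and then the `λ`-polynomials of their coefficients vanish identically, whence
  the moments `τ_{jk} = Σ_t t^k P_j(t)` (`k ≤ j < p`) vanish, whence (power sums `Σ_t t^e`, `powSum_*`) the
  coefficients `a_{ij}`, `i + j ≥ p - 1`, vanish;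
* §4 `hl2_coord` (lines in slope form) → `hl2_gen` (general lines `αa + α'b = γ`, by a shear `a ↦ a + s b`
  with `α_i s + α'_i ≠ 0 ∀ i`, `s` by pigeonhole) → `hl_abstract` (pull back to the coordinate plane
  `x + a•u + b•w` through each point; `(u, w)` chosen so that none of the `< p²` nonzero functionals
  `φ_i`, `b_i φ_j - b_j φ_i` (`b_i = c_i - φ_i x ≠ 0`) kills both — `card_ker_mul`, `exists_pair_avoiding`).
-/

set_option autoImplicit false

namespace Summit.QuantumAdvantage.AdviceFreeQNC0.PlaneDiv.HL

open Polynomial Finset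

variable {p : ℕ} [Fact p.Prime]

/-- Evaluation hom at the point `(a, b)`. -/
noncomputable def evHom (a b : ZMod p) : Polynomial (Polynomial (ZMod p)) →+* ZMod p :=
  (evalRingHom b).comp (mapRingHom (evalRingHom a))

/-- Evaluation of a bivariate polynomial at `(a, b)`. -/
noncomputable def ev (P : Polynomial (Polynomial (ZMod p))) (a b : ZMod p) : ZMod p := evHom a b P

/-- Unfolding of `ev`: evaluate the coefficients at `a`, then the outer variable at `b`. -/
theorem ev_def (P : Polynomial (Polynomial (ZMod p))) (a b : ZMod p) :
    ev P a b = (P.map (evalRingHom a)).eval b := rfl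

/-- `ev` is additive. -/
@[simp] theorem ev_add (P Q : Polynomial (Polynomial (ZMod p))) (a b : ZMod p) :
    ev (P + Q) a b = ev P a b + ev Q a b := by simp [ev]

/-- `ev` respects subtraction. -/
@[simp] theorem ev_sub (P Q : Polynomial (Polynomial (ZMod p))) (a b : ZMod p) :
    ev (P - Q) a b = ev P a b - ev Q a b := by simp [ev]

/-- `ev` is multiplicative. -/
@[simp] theorem ev_mul (P Q : Polynomial (Polynomial (ZMod p))) (a b : ZMod p) :
    ev (P * Q) a b = ev P a b * ev Q a b := by simp [ev]

/-- `ev` respects powers. -/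
@[simp] theorem ev_pow (P : Polynomial (Polynomial (ZMod p))) (a b : ZMod p) (n : ℕ) :
    ev (P ^ n) a b = ev P a b ^ n := by simp [ev]

/-- `ev 0 = 0`. -/
@[simp] theorem ev_zero (a b : ZMod p) : ev (0 : Polynomial (Polynomial (ZMod p))) a b = 0 := by
  simp [ev]

/-- `ev 1 = 1`. -/
@[simp] theorem ev_one (a b : ZMod p) : ev (1 : Polynomial (Polynomial (ZMod p))) a b = 1 := by
  simp [ev]

/-- `ev` of a constant (in the outer variable) is the evaluation of that coefficient polynomial at `a`. -/
@[simp] theorem ev_C (r : Polynomial (ZMod p)) (a b : ZMod p) : ev (C r) a b = r.eval a := by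
  simp [ev, evHom]

/-- `ev` of the outer variable is the second coordinate `b`. -/
@[simp] theorem ev_X (a b : ZMod p) : ev (X : Polynomial (Polynomial (ZMod p))) a b = b := by
  simp [ev, evHom]

/-- `ev` commutes with finite sums. -/
theorem ev_sum {ι : Type*} (s : Finset ι) (f : ι → Polynomial (Polynomial (ZMod p)))
    (a b : ZMod p) : ev (∑ i ∈ s, f i) a b = ∑ i ∈ s, ev (f i) a b := by
  simp [ev, map_sum]

/-- Substituting the outer variable by `ℓ(a)` and then `a`: the restriction to the
curve `b = ℓ(a)`. -/
theorem eval_eval_eq_ev (P : Polynomial (Polynomial (ZMod p))) (ℓ : Polynomial (ZMod p))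
    (a : ZMod p) : (P.eval ℓ).eval a = ev P a (ℓ.eval a) := by
  rw [ev_def, eval_map]
  have h := Polynomial.hom_eval₂ P (RingHom.id _) (evalRingHom a) ℓ
  rw [RingHom.comp_id, coe_evalRingHom, eval₂_id] at h
  -- h : eval a (eval ℓ P) = eval₂ (evalRingHom a) (eval a ℓ) P
  exact h

/-- The line polynomial `μ + ν·a`. -/
noncomputable def lineP (μ ν : ZMod p) : Polynomial (ZMod p) := C μ + C ν * X

/-- The line polynomial `lineP μ ν` evaluates to `μ + ν a`. -/
@[simp] theorem eval_lineP (μ ν a : ZMod p) : (lineP μ ν).eval a = μ + ν * a := by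
  simp [lineP]

/-- The line polynomial has degree `≤ 1`. -/
theorem natDegree_lineP_le (μ ν : ZMod p) : (lineP μ ν).natDegree ≤ 1 := by
  unfold lineP
  refine (natDegree_add_le _ _).trans ?_
  refine max_le (by simp) ?_
  exact (natDegree_C_mul_le _ _).trans (by simp)

/-- Restriction to a line has degree ≤ the total degree. -/
theorem natDegree_eval_le {D : ℕ} {P : Polynomial (Polynomial (ZMod p))}
    (hP : ∀ j, P.coeff j ≠ 0 → (P.coeff j).natDegree + j ≤ D)
    {ℓ : Polynomial (ZMod p)} (hℓ : ℓ.natDegree ≤ 1) : (P.eval ℓ).natDegree ≤ D := by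
  rw [eval_eq_sum_range]
  apply natDegree_sum_le_of_forall_le
  intro j _
  by_cases hj : P.coeff j = 0
  · simp [hj]
  · have h1 := hP j hj
    calc (P.coeff j * ℓ ^ j).natDegree ≤ (P.coeff j).natDegree + (ℓ ^ j).natDegree :=
          natDegree_mul_le
      _ ≤ (P.coeff j).natDegree + j * ℓ.natDegree := by
          gcongr; exact natDegree_pow_le
      _ ≤ (P.coeff j).natDegree + j * 1 := by gcongr
      _ ≤ D := by simpa using h1

/-- A univariate polynomial over `𝔽_p` of degree `< p` vanishing everywhere is zero. -/
theorem poly_eq_zero_of_eval {Q : Polynomial (ZMod p)} (hdeg : Q.natDegree < p)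
    (hev : ∀ a : ZMod p, Q.eval a = 0) : Q = 0 := by
  refine eq_zero_of_natDegree_lt_card_of_eval_eq_zero Q (f := id) Function.injective_id
    (fun a => hev a) ?_
  simpa [ZMod.card] using hdeg

/-- Same with one exceptional point allowed, for degree `< p - 1`. -/
theorem poly_eq_zero_of_eval_off_one {Q : Polynomial (ZMod p)} (hdeg : Q.natDegree + 1 < p)
    (a₀ : ZMod p) (hev : ∀ a : ZMod p, a ≠ a₀ → Q.eval a = 0) : Q = 0 := by
  classical
  refine eq_zero_of_natDegree_lt_card_of_eval_eq_zero Q (ι := {a : ZMod p // ¬ a = a₀})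
    (f := Subtype.val) Subtype.val_injective (fun a => hev a.1 a.2) ?_
  rw [Fintype.card_subtype_compl, ZMod.card, Fintype.card_unique]
  omega

/-- Peeling one linear factor: if `P` (total degree ≤ D < p) vanishes on the line
`b = μ + ν a`, then `P = (Y - ℓ) · Q` with `Q` of total degree `≤ D - 1`. -/
theorem peel {D : ℕ} {P : Polynomial (Polynomial (ZMod p))}
    (hP : ∀ j, P.coeff j ≠ 0 → (P.coeff j).natDegree + j ≤ D) (hD : D < p)
    {μ ν : ZMod p} (hvan : ∀ a, ev P a (μ + ν * a) = 0) :
    (X - C (lineP μ ν)) * (P /ₘ (X - C (lineP μ ν))) = P ∧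
      (∀ j, (P /ₘ (X - C (lineP μ ν))).coeff j ≠ 0 →
        ((P /ₘ (X - C (lineP μ ν))).coeff j).natDegree + j ≤ D - 1) := by
  set ℓ := lineP μ ν with hℓdef
  have hℓ : ℓ.natDegree ≤ 1 := natDegree_lineP_le μ ν
  -- root
  have hroot : IsRoot P ℓ := by
    show P.eval ℓ = 0
    apply poly_eq_zero_of_eval (lt_of_le_of_lt (natDegree_eval_le hP hℓ) hD)
    intro a
    rw [eval_eval_eq_ev, hℓdef, eval_lineP]
    exact hvan a
  refine ⟨mul_divByMonic_eq_iff_isRoot.mpr hroot, ?_⟩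
  set Q := P /ₘ (X - C ℓ) with hQdef
  -- if P = 0 then Q = 0
  by_cases hP0 : P = 0
  · have : Q = 0 := by rw [hQdef, hP0, zero_divByMonic]
    rw [this]; intro j hj; simp at hj
  -- natDegree P ≥ 1
  have hPdeg : 1 ≤ P.natDegree := by
    by_contra hlt
    have h0 : P.natDegree = 0 := by omega
    have hPC : P = C (P.coeff 0) := eq_C_of_natDegree_eq_zero h0
    have : P.coeff 0 = 0 := by
      have hr := hroot
      rw [IsRoot, hPC, eval_C] at hr
      exact hr
    apply hP0; rw [hPC, this, map_zero]
  have hQnat : Q.natDegree = P.natDegree - 1 := by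
    rw [hQdef, natDegree_divByMonic _ (monic_X_sub_C ℓ), natDegree_X_sub_C]
  -- downward induction
  have key : ∀ k n, P.natDegree ≤ n + k → Q.coeff n ≠ 0 → (Q.coeff n).natDegree + n + 1 ≤ D := by
    intro k
    induction k with
    | zero =>
      intro n hn hQn
      exfalso; apply hQn
      apply coeff_eq_zero_of_natDegree_lt
      omega
    | succ k ih =>
      intro n hn hQn
      have hrec : Q.coeff n = P.coeff (n + 1) + ℓ * Q.coeff (n + 1) := by
        rw [hQdef]; exact coeff_divByMonic_X_sub_C_rec P ℓ n
      have ih' := ih (n + 1) (by omega)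
      -- bounds on the two terms
      have hb1 : (P.coeff (n + 1)).natDegree + n + 1 ≤ D ∨ P.coeff (n + 1) = 0 := by
        by_cases h : P.coeff (n + 1) = 0
        · exact Or.inr h
        · left; have := hP (n + 1) h; omega
      have hb2 : (Q.coeff (n + 1)).natDegree + n + 2 ≤ D ∨ Q.coeff (n + 1) = 0 := by
        by_cases h : Q.coeff (n + 1) = 0
        · exact Or.inr h
        · left; have := ih' h; omega
      have hsum : (Q.coeff n).natDegree ≤
          max (P.coeff (n + 1)).natDegree (ℓ * Q.coeff (n + 1)).natDegree := by
        rw [hrec]; exact natDegree_add_le _ _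
      have hmul : (ℓ * Q.coeff (n + 1)).natDegree ≤ 1 + (Q.coeff (n + 1)).natDegree := by
        by_cases h : Q.coeff (n + 1) = 0
        · simp [h]
        · exact natDegree_mul_le.trans (by gcongr)
      rcases hb1 with hb1 | hb1 <;> rcases hb2 with hb2 | hb2
      · have := le_max_iff.mp (le_refl (max (P.coeff (n + 1)).natDegree
            (ℓ * Q.coeff (n + 1)).natDegree))
        rcases le_total (P.coeff (n + 1)).natDegree (ℓ * Q.coeff (n + 1)).natDegree with h | h
        · rw [max_eq_right h] at hsum; omega
        · rw [max_eq_left h] at hsum; omega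
      · rw [hb2, mul_zero, natDegree_zero, Nat.max_zero] at hsum
        omega
      · rw [hb1, natDegree_zero, Nat.zero_max] at hsum
        omega
      · exfalso; apply hQn; rw [hrec, hb1, hb2, mul_zero, add_zero]
  intro j hj
  have := key P.natDegree j (by omega) hj
  omega

end Summit.QuantumAdvantage.AdviceFreeQNC0.PlaneDiv.HL

namespace Summit.QuantumAdvantage.AdviceFreeQNC0.PlaneDiv.HL

open Polynomial Finset

variable {p : ℕ} [Fact p.Prime]

/-- After peeling the line `(μ, ν)`, the quotient still vanishes on every other line. -/
theorem vanish_quot {D : ℕ} {Q : Polynomial (Polynomial (ZMod p))}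
    (hQ : ∀ j, Q.coeff j ≠ 0 → (Q.coeff j).natDegree + j ≤ D)
    (hD : D + 1 < p) {μ ν μ' ν' : ZMod p} (hne : (μ', ν') ≠ (μ, ν))
    (hvan : ∀ a, ev ((X - C (lineP μ ν)) * Q) a (μ' + ν' * a) = 0) :
    ∀ a, ev Q a (μ' + ν' * a) = 0 := by
  -- an exceptional parameter a₀ off which the two lines differ
  obtain ⟨a₀, ha₀⟩ : ∃ a₀ : ZMod p, ∀ a, a ≠ a₀ → μ' + ν' * a ≠ μ + ν * a := by
    by_cases hν : ν' = ν
    · refine ⟨0, fun a _ h => ?_⟩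
      apply hne
      rw [hν] at h ⊢
      have : μ' = μ := by
        have := h; rw [add_left_inj] at this; exact this
      rw [this]
    · refine ⟨(μ - μ') / (ν' - ν), fun a ha h => ?_⟩
      apply ha
      have hνne : ν' - ν ≠ 0 := sub_ne_zero.mpr hν
      field_simp
      linear_combination h
  have hQ' : Q.eval (lineP μ' ν') = 0 := by
    apply poly_eq_zero_of_eval_off_one (a₀ := a₀)
    · have := natDegree_eval_le hQ (natDegree_lineP_le μ' ν')
      omega
    · intro a ha
      rw [eval_eval_eq_ev, eval_lineP]
      have h := hvan a
      rw [ev_mul, ev_sub, ev_X, ev_C, eval_lineP] at h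
      rcases mul_eq_zero.mp h with h | h
      · exact absurd (sub_eq_zero.mp h) (ha₀ a ha)
      · exact h
  intro a
  have := congrArg (fun R => R.eval a) hQ'
  simp only [eval_eval_eq_ev, eval_lineP, eval_zero] at this
  exact this

/-- Total degree `0` forces `P` to be a constant. -/
theorem eq_C_C_of_TD_zero {P : Polynomial (Polynomial (ZMod p))}
    (hP : ∀ j, P.coeff j ≠ 0 → (P.coeff j).natDegree + j ≤ 0) :
    P = C (C ((P.coeff 0).coeff 0)) := by
  ext j i
  by_cases hj : j = 0
  · subst hj
    by_cases hi : i = 0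
    · subst hi; simp
    · rw [coeff_C, if_pos rfl, coeff_C, if_neg hi]
      by_cases h0 : P.coeff 0 = 0
      · simp [h0]
      · have := hP 0 h0
        apply coeff_eq_zero_of_natDegree_lt
        omega
  · rw [coeff_C, if_neg hj, coeff_zero]
    by_cases h0 : P.coeff j = 0
    · simp [h0]
    · have := hP j h0
      omega

/-- Iterated peeling: a polynomial of total degree ≤ `D` vanishing on `D + 1` lines with
pairwise distinct parameters `(μ_i, ν_i)` is zero (needs `D + 2 ≤ p`). -/
theorem eq_zero_of_lines : ∀ (D : ℕ) (P : Polynomial (Polynomial (ZMod p))),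
    (∀ j, P.coeff j ≠ 0 → (P.coeff j).natDegree + j ≤ D) →
    D + 2 ≤ p → ∀ (L : Fin (D + 1) → ZMod p × ZMod p), Function.Injective L →
    (∀ i a, ev P a ((L i).1 + (L i).2 * a) = 0) → P = 0 := by
  intro D
  induction D with
  | zero =>
    intro P hP _ L _ hvan
    have hC := eq_C_C_of_TD_zero hP
    have h0 := hvan 0 0
    rw [hC, ev_C, eval_C] at h0
    rw [hC, h0, map_zero, map_zero]
  | succ D ih =>
    intro P hP hDp L hL hvan
    obtain ⟨hfac, hTD⟩ := peel hP (by omega) (μ := (L 0).1) (ν := (L 0).2) (hvan 0)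
    simp only [Nat.add_sub_cancel] at hTD
    set Q := P /ₘ (X - C (lineP (L 0).1 (L 0).2))
    have hQ0 : Q = 0 := by
      refine ih Q hTD (by omega) (fun i => L i.succ) (fun i j h => Fin.succ_injective _ (hL h)) ?_
      intro i a
      have hne : ((L i.succ).1, (L i.succ).2) ≠ ((L 0).1, (L 0).2) := by
        simp only [Prod.mk.eta]
        intro h
        exact Fin.succ_ne_zero i (hL h)
      refine vanish_quot hTD (by omega) hne ?_ a
      intro a'
      rw [hfac]
      exact hvan i.succ a'
    rw [← hfac, hQ0, mul_zero]

end Summit.QuantumAdvantage.AdviceFreeQNC0.PlaneDiv.HL
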